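import Mathlib
import Literature.NumberTheory.LFunctions.Zhang2022.Section8ProfilesAtPz
import Literature.NumberTheory.LFunctions.Zhang2022.Section8SubstitutionEngine
import HarnessLib

/-!
# Zhang (2022) §8 p. 49: the four "Substituting `x = Pᶻ`" displays with explicit `O(α𝓛⁻⁷)`
# — DAG nodes `Z22:§8.u051`–`Z22:§8.u054`, DISCHARGED (part 2 of 2)

Topic `Literature/NumberTheory/LFunctions/Zhang2022` (Landau–Siegel audit tree; verdict-neutral).
Y. Zhang, *Discrete mean estimates and the Landau–Siegel zero*, arXiv:2211.02515v1 (2022)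
[Zhang2022LandauSiegel] — **an unrefereed manuscript under adjudication** (D-0069 width campaign,
layer L2, discharge seat sz-d19). The four displays after (8.18) (tex L2506–L2521, p. 49):
`(log P₁)⁻²∫₁^{P₁}𝔣_{j6}𝔤_{j6}dx/x = (0.504² log P)⁻¹∫₀^{0.504}𝔣𝔣_{j6}𝔤𝔥_{j6}dz + o(α)` and its three
companions (`μ = 7` with `P₂`; the two cross terms with `𝔤_{j6}(P^{0.004}T^{10}x)`,
`𝔣_{j6}(P^{0.004}T^{10}x)`), typed as `Section8dStatements.Step8u051 c′`–`Step8u054 c′` (slice L2-t9).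
This file PROVES them in the QUANTITATIVE form requested by the assembler of `Skeleton.Ded823`
(sz-d29, STATUS 2026-08-25T23:39:58Z): `∃ C, ForAllLarge …, ∀ j ∈ {1,2,3}, ‖LHS − main‖ ≤ C·α·𝓛⁻⁷`
(`step8u051q_holds` … `step8u054q_holds`), and then the typed `o(α)` forms (`step8u051_holds` …
`step8u054_holds`). Route: exact substitution `x = Pᶻ` (tree `display818_diag/cross₁/cross₂`,
`Section8ChangeOfVariables`, with `P₁ = Ppow 𝓛⁹ 0.504`, `P₂ = Ppow 𝓛⁹ θ₂`, `θ₂ = log P₂/𝓛⁹`,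
`P^{0.004}T^{10} = P₁/P₂`), then `integral_perturbation` (`Section8SubstitutionEngine`) fed with
`𝔣_{jμ}(Pᶻ)𝔤_{jμ′}(Pʷ) = 𝔣𝔣_{jμ}(z)𝔤𝔥_{jμ′}(w) + O(𝓛⁻⁸)` (`Section8ProfilesAtPz`), `|𝔣𝔣|, |𝔤𝔥| ≤ 6`,
`|θ₂ − 0.5| ≤ 10𝓛⁻⁷`, and the Lipschitz bounds `≤ 50|z − w|` for `𝔣𝔣_{j6}`, `𝔤𝔥_{j6}`; every error is
divided by `log P = 𝓛⁹ = π/α`. Thresholds: `D ≥ 8` (so that `𝓛 ≥ 2`, `θ₂ ∈ [0.4, 0.5]`).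

WHAT THIS FILE IS NOT: a statement about (8.11)/(8.12), `Step8u055`, (8.23)–(8.24), or Theorems 1–2 /
Landau–Siegel zeros. No definitions, no new facts.

## References

* Y. Zhang, arXiv:2211.02515v1 (2022), §8 p. 49 (tex L2506–L2521), (8.12)–(8.18); §2 (2.6), (2.10),
  (2.21). [cite: Zhang2022LandauSiegel, §8 p.49]
-/

noncomputable section

open Complex Real MeasureTheory Set

namespace Literature.NumberTheory.LFunctions.Zhang2022.Section8SubstitutionDisplays

open Skeleton Section8dStatements Section8ShiftPerturbation Section8ProfilesAtPz
  Section8SubstitutionEngine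

section Pointwise

variable (c' : ℝ) {D : ℕ}

/-- `‖𝔣_{jμ}(Pᶻ) − 𝔣𝔣_{jμ}(z)‖ ≤ K𝓛⁻⁸` for `μ ∈ {6,7}` (`K = 75|c′|π² + 40c′²π³`; from
`profiles_six/seven`). [cite: Zhang2022LandauSiegel, §8 p.48–49] -/
theorem frakfW_close (hD : 3 ≤ D) {j : ℕ} (hj : j ∈ ({1, 2, 3} : Finset ℕ)) {μ : ℕ}
    (hμ : μ = 6 ∨ μ = 7) {z : ℝ} (hz0 : 0 ≤ z) (hz1 : z ≤ 1) :
    ‖frakfW c' D j μ (bigP D ^ z) - ffP j μ z‖ ≤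
      (75 * |c'| * π ^ 2 + 40 * |c'| ^ 2 * π ^ 3) * (ell D ^ 8)⁻¹ := by
  rcases hμ with rfl | rfl
  · exact (profiles_six c' hD hj hz0 hz1).1
  · exact (profiles_seven c' hD hj hz0 hz1).1

/-- `‖𝔤_{jμ}(Pᶻ) − 𝔤𝔥_{jμ}(z)‖ ≤ K𝓛⁻⁸` for `μ ∈ {6,7}`. [cite: Zhang2022LandauSiegel, §8 p.48–49] -/
theorem frakgW_close (hD : 3 ≤ D) {j : ℕ} (hj : j ∈ ({1, 2, 3} : Finset ℕ)) {μ : ℕ}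
    (hμ : μ = 6 ∨ μ = 7) {z : ℝ} (hz0 : 0 ≤ z) (hz1 : z ≤ 1) :
    ‖frakgW c' D j μ (bigP D ^ z) - ghP j μ z‖ ≤
      (75 * |c'| * π ^ 2 + 40 * |c'| ^ 2 * π ^ 3) * (ell D ^ 8)⁻¹ := by
  rcases hμ with rfl | rfl
  · exact (profiles_six c' hD hj hz0 hz1).2
  · exact (profiles_seven c' hD hj hz0 hz1).2

/-- **The integrands**: `‖𝔣_{jμ}(Pᶻ)𝔤_{jμ′}(Pʷ) − 𝔣𝔣_{jμ}(z)𝔤𝔥_{jμ′}(w)‖ ≤ (12K + K²)𝓛⁻⁸` for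
`z, w ∈ [0,1]`, `μ, μ′ ∈ {6,7}`, `D ≥ 3`. [cite: Zhang2022LandauSiegel, §8 p.49] -/
theorem product_close (hD : 3 ≤ D) {j : ℕ} (hj : j ∈ ({1, 2, 3} : Finset ℕ)) {μ μ' : ℕ}
    (hμ : μ = 6 ∨ μ = 7) (hμ' : μ' = 6 ∨ μ' = 7) {z w : ℝ} (hz0 : 0 ≤ z) (hz1 : z ≤ 1)
    (hw0 : 0 ≤ w) (hw1 : w ≤ 1) :
    ‖frakfW c' D j μ (bigP D ^ z) * frakgW c' D j μ' (bigP D ^ w) - ffP j μ z * ghP j μ' w‖ ≤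
      (12 * (75 * |c'| * π ^ 2 + 40 * |c'| ^ 2 * π ^ 3) +
        (75 * |c'| * π ^ 2 + 40 * |c'| ^ 2 * π ^ 3) ^ 2) * (ell D ^ 8)⁻¹ := by
  set K : ℝ := 75 * |c'| * π ^ 2 + 40 * |c'| ^ 2 * π ^ 3 with hK
  set t : ℝ := (ell D ^ 8)⁻¹ with ht
  have hℓ1 : 1 ≤ ell D := (one_lt_ell' hD).le
  have ht0 : 0 ≤ t := by rw [ht]; positivity
  have ht1 : t ≤ 1 := by rw [ht]; exact inv_le_one_of_one_le₀ (one_le_pow₀ hℓ1)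
  have hK0 : 0 ≤ K := by rw [hK]; positivity
  have hz : |z| ≤ 1 := abs_le.mpr ⟨by linarith, hz1⟩
  have hw : |w| ≤ 1 := abs_le.mpr ⟨by linarith, hw1⟩
  have h := norm_mul_sub_mul_le_of_bounds (frakfW_close c' hD hj hμ hz0 hz1)
    (frakgW_close c' hD hj hμ' hw0 hw1) (norm_ffP_le j μ hz) (norm_ghP_le j μ' hw)
  refine h.trans ?_
  have : K * t * (6 + K * t) + 6 * (K * t) ≤ (12 * K + K ^ 2) * t := by
    nlinarith [mul_nonneg hK0 ht0, mul_nonneg (mul_nonneg hK0 hK0) (mul_nonneg ht0 (sub_nonneg.2 ht1))]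
  linarith

end Pointwise

/-! ## Prefactor arithmetic for `θ₂ ∈ [0.4, 0.5]` -/

/-- For `0.4 ≤ θ ≤ 0.5`, `Λ > 0`: `|1/(θ²Λ)| ≤ 7/Λ` and `|1/(θ²Λ) − 1/(0.5²Λ)| ≤ 25|θ − 0.5|/Λ`.
[cite: Zhang2022LandauSiegel, §8 p.49] -/
theorem prefactor_diag {θ Λ : ℝ} (hΛ : 0 < Λ) (h1 : 0.4 ≤ θ) (h2 : θ ≤ 0.5) :
    |1 / (θ ^ 2 * Λ)| ≤ 7 / Λ ∧ |1 / (θ ^ 2 * Λ) - 1 / (0.5 ^ 2 * Λ)| ≤ 25 * |θ - 0.5| / Λ := by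
  have hθ : 0 < θ := by linarith
  have hθ2 : 0.16 ≤ θ ^ 2 := by nlinarith
  constructor
  · rw [abs_of_pos (by positivity), div_le_div_iff₀ (by positivity) hΛ]
    nlinarith [mul_le_mul_of_nonneg_right hθ2 hΛ.le]
  · have e : 1 / (θ ^ 2 * Λ) - 1 / (0.5 ^ 2 * Λ) = (0.5 - θ) * ((0.5 + θ) / (0.25 * θ ^ 2 * Λ)) := by
      field_simp; ring
    rw [e, abs_mul, abs_sub_comm, abs_of_pos (by positivity : (0:ℝ) < (0.5 + θ) / (0.25 * θ ^ 2 * Λ))]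
    have hfac : (0.5 + θ) / (0.25 * θ ^ 2 * Λ) ≤ 25 / Λ := by
      rw [div_le_div_iff₀ (by positivity) hΛ]
      nlinarith [mul_le_mul_of_nonneg_right hθ2 hΛ.le]
    calc |θ - 0.5| * ((0.5 + θ) / (0.25 * θ ^ 2 * Λ)) ≤ |θ - 0.5| * (25 / Λ) :=
          mul_le_mul_of_nonneg_left hfac (abs_nonneg _)
      _ = 25 * |θ - 0.5| / Λ := by ring

/-- For `0.4 ≤ θ`, `Λ > 0`: `|1/(0.504·θ·Λ)| ≤ 5/Λ` and
`|1/(0.504θΛ) − 1/(0.5·0.504·Λ)| ≤ 10|θ − 0.5|/Λ`. [cite: Zhang2022LandauSiegel, §8 p.49] -/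
theorem prefactor_cross {θ Λ : ℝ} (hΛ : 0 < Λ) (h1 : 0.4 ≤ θ) :
    |1 / (0.504 * θ * Λ)| ≤ 5 / Λ ∧
      |1 / (0.504 * θ * Λ) - 1 / (0.5 * 0.504 * Λ)| ≤ 10 * |θ - 0.5| / Λ := by
  have hθ : 0 < θ := by linarith
  constructor
  · rw [abs_of_pos (by positivity), div_le_div_iff₀ (by positivity) hΛ]
    nlinarith [mul_le_mul_of_nonneg_right h1 hΛ.le]
  · have e : 1 / (0.504 * θ * Λ) - 1 / (0.5 * 0.504 * Λ) = (0.5 - θ) * (1 / (0.252 * θ * Λ)) := by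
      field_simp; ring
    rw [e, abs_mul, abs_sub_comm, abs_of_pos (by positivity : (0:ℝ) < 1 / (0.252 * θ * Λ))]
    have hfac : 1 / (0.252 * θ * Λ) ≤ 10 / Λ := by
      rw [div_le_div_iff₀ (by positivity) hΛ]
      nlinarith [mul_le_mul_of_nonneg_right h1 hΛ.le]
    calc |θ - 0.5| * (1 / (0.252 * θ * Λ)) ≤ |θ - 0.5| * (10 / Λ) :=
          mul_le_mul_of_nonneg_left hfac (abs_nonneg _)
      _ = 10 * |θ - 0.5| / Λ := by ring

/-- `θ₂ = log P₂/𝓛⁹ ∈ [0.4, 0.5]` and `|θ₂ − 0.5| ≤ 10𝓛⁻⁷` once `𝓛 ≥ 2`.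
[cite: Zhang2022LandauSiegel, §2 (2.21)] -/
theorem theta2_bounds {D : ℕ} (hℓ : 2 ≤ ell D) :
    0.4 ≤ Real.log (Skeleton.P2 D) / ell D ^ 9 ∧ Real.log (Skeleton.P2 D) / ell D ^ 9 ≤ 0.5 ∧
      |Real.log (Skeleton.P2 D) / ell D ^ 9 - 0.5| ≤ 10 * (ell D ^ 7)⁻¹ := by
  have hℓ1 : 1 ≤ ell D := by linarith
  have h := theta2_sub_half hℓ1
  have h7 : (2:ℝ) ^ 7 ≤ ell D ^ 7 := pow_le_pow_left₀ (by norm_num) hℓ 7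
  have h7' : 10 * (ell D ^ 7)⁻¹ ≤ 0.1 := by
    rw [← div_eq_mul_inv, div_le_iff₀ (by positivity)]; nlinarith
  have hle : Real.log (Skeleton.P2 D) / ell D ^ 9 ≤ 0.5 := by
    rw [log_P2, div_le_iff₀ (by positivity)]
    have : 0 ≤ ell D ^ (1.1 : ℝ) := by positivity
    nlinarith
  refine ⟨?_, hle, h⟩
  have := (abs_le.mp (h.trans h7')).1
  linarith

/-! ## The four displays, quantitative form `‖LHS − main‖ ≤ C·α·𝓛⁻⁷` -/

section Quantitative

variable (c' : ℝ)

/-- **`Z22:§8.u051`, quantitative** (p. 49, tex L2506): for `1 ≤ j ≤ 3`,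
`‖(log P₁)⁻² ∫₁^{P₁} 𝔣_{j6}(x)𝔤_{j6}(x) dx/x − (0.504² log P)⁻¹ ∫₀^{0.504} 𝔣𝔣_{j6}𝔤𝔥_{j6} dz‖ ≤ C·α·𝓛⁻⁷`
for `D ≥ 8` (in fact `O(α𝓛⁻⁸)`: `P₁ = P^{0.504}` exactly). [cite: Zhang2022LandauSiegel, §8 p.49, tex L2506] -/
theorem step8u051q_holds : ∃ C : ℝ, ForAllLarge fun D _ _ => ∀ j ∈ ({1, 2, 3} : Finset ℕ),
    ‖1 / (Real.log (Skeleton.P1 D) : ℂ) ^ 2 *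
          (∫ x in (1 : ℝ)..Skeleton.P1 D, frakfW c' D j 6 x * frakgW c' D j 6 x / x) -
        ((1 / (0.504 ^ 2 * Real.log (bigP D)) : ℝ) : ℂ) *
          ∫ z in (0 : ℝ)..0.504, ffP j 6 z * ghP j 6 z‖ ≤ C * alpha D * (ell D ^ 7)⁻¹ := by
  set K : ℝ := 75 * |c'| * π ^ 2 + 40 * |c'| ^ 2 * π ^ 3 with hK
  refine ⟨(12 * K + K ^ 2) / (0.504 * π), 8, fun D _ χ hD _ _ j hj => ?_⟩
  have hD3 : 3 ≤ D := le_trans (by norm_num) hD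
  have hℓ2 : 2 ≤ ell D := two_le_ell hD
  have hℓ1 : 1 ≤ ell D := by linarith
  set Λ : ℝ := ell D ^ 9 with hΛdef
  have hΛ : 0 < Λ := by rw [hΛdef]; positivity
  have hK0 : 0 ≤ K := by rw [hK]; positivity
  have hlog : Real.log (bigP D) = Λ := by rw [bigP, Real.log_exp]
  rw [P1_eq_Ppow, hlog, display818_diag hΛ (by norm_num : (0.504:ℝ) ≠ 0)
    (F := frakfW c' D j 6) (G := frakgW c' D j 6) (f := fun z => frakfW c' D j 6 (rexp (Λ * z)))
    (g := fun z => frakgW c' D j 6 (rexp (Λ * z))) (fun _ => rfl) (fun _ => rfl)]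
  have hU : IntervalIntegrable (fun z => frakfW c' D j 6 (rexp (Λ * z)) * frakgW c' D j 6 (rexp (Λ * z)))
      volume 0 0.504 :=
    ((continuous_frakfW_exp c' D j 6 Λ).mul (continuous_frakgW_exp c' D j 6 Λ)).intervalIntegrable _ _
  have hV : Continuous fun z => ffP j 6 z * ghP j 6 z :=
    (continuous_ffP_ghP j 6).1.mul (continuous_ffP_ghP j 6).2
  have hUV : ∀ z ∈ Icc (0:ℝ) 0.504,
      ‖frakfW c' D j 6 (rexp (Λ * z)) * frakgW c' D j 6 (rexp (Λ * z)) - ffP j 6 z * ghP j 6 z‖ ≤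
        (12 * K + K ^ 2) * (ell D ^ 8)⁻¹ := by
    intro z hz
    rw [hΛdef, ← bigP_rpow_eq_exp]
    exact product_close c' hD3 hj (Or.inl rfl) (Or.inl rfl) hz.1 (hz.2.trans (by norm_num)) hz.1
      (hz.2.trans (by norm_num))
  have hM : ∀ z ∈ Icc (0:ℝ) (max 0.504 0.504), ‖ffP j 6 z * ghP j 6 z‖ ≤ 36 := by
    intro z hz
    rw [max_self] at hz
    have hz' : |z| ≤ 1 := abs_le.mpr ⟨by linarith [hz.1], hz.2.trans (by norm_num)⟩
    rw [norm_mul]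
    nlinarith [norm_ffP_le j 6 hz', norm_ghP_le j 6 hz', norm_nonneg (ffP j 6 z),
      norm_nonneg (ghP j 6 z)]
  have key := integral_perturbation (p := 1 / (0.504 ^ 2 * Λ)) (p₀ := 1 / (0.504 ^ 2 * Λ))
    (by norm_num) (by norm_num) hU hV hUV hM
  simp only [sub_self, abs_zero, zero_mul, mul_zero, add_zero] at key
  refine key.trans ?_
  rw [abs_of_pos (by positivity)]
  have hαΛ : alpha D * Λ = π := by rw [hΛdef]; exact alpha_mul_ell_pow_nine hD3
  have hα0 : alpha D ≠ 0 := (alpha_pos' hD3).ne'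
  have ht87 : (ell D ^ 8)⁻¹ ≤ (ell D ^ 7)⁻¹ := by
    apply inv_anti₀ (by positivity)
    calc ell D ^ 7 = ell D ^ 7 * 1 := (mul_one _).symm
      _ ≤ ell D ^ 7 * ell D := by gcongr
      _ = ell D ^ 8 := by ring
  have h87' : 0 ≤ (ell D ^ 7)⁻¹ := by positivity
  -- `(1/(0.504²Λ))·0.504·(12K+K²)t = (12K+K²)/(0.504π)·α·t ≤ C·α·𝓛⁻⁷`
  calc 1 / (0.504 ^ 2 * Λ) * (0.504 * ((12 * K + K ^ 2) * (ell D ^ 8)⁻¹))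
      = (12 * K + K ^ 2) / (0.504 * π) * alpha D * (ell D ^ 8)⁻¹ := by
        rw [← hαΛ]; field_simp
    _ ≤ (12 * K + K ^ 2) / (0.504 * π) * alpha D * (ell D ^ 7)⁻¹ := by
        have : 0 ≤ (12 * K + K ^ 2) / (0.504 * π) * alpha D :=
          mul_nonneg (by positivity) (alpha_pos' hD3).le
        exact mul_le_mul_of_nonneg_left ht87 this

/-- **`Z22:§8.u052`, quantitative** (p. 49, tex L2509): for `1 ≤ j ≤ 3`,
`‖(log P₂)⁻² ∫₁^{P₂} 𝔣_{j7}(x)𝔤_{j7}(x) dx/x − (0.5² log P)⁻¹ ∫₀^{0.5} 𝔣𝔣_{j7}𝔤𝔥_{j7} dz‖ ≤ C·α·𝓛⁻⁷` for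
`D ≥ 8` (`log P₂ = θ₂ log P`, `|θ₂ − 0.5| ≤ 10𝓛⁻⁷`). [cite: Zhang2022LandauSiegel, §8 p.49, tex L2509] -/
theorem step8u052q_holds : ∃ C : ℝ, ForAllLarge fun D _ _ => ∀ j ∈ ({1, 2, 3} : Finset ℕ),
    ‖1 / (Real.log (Skeleton.P2 D) : ℂ) ^ 2 *
          (∫ x in (1 : ℝ)..Skeleton.P2 D, frakfW c' D j 7 x * frakgW c' D j 7 x / x) -
        ((1 / (0.5 ^ 2 * Real.log (bigP D)) : ℝ) : ℂ) *
          ∫ z in (0 : ℝ)..0.5, ffP j 7 z * ghP j 7 z‖ ≤ C * alpha D * (ell D ^ 7)⁻¹ := by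
  set K : ℝ := 75 * |c'| * π ^ 2 + 40 * |c'| ^ 2 * π ^ 3 with hK
  refine ⟨(3.5 * (12 * K + K ^ 2) + 7020) / π, 8, fun D _ χ hD _ _ j hj => ?_⟩
  have hD3 : 3 ≤ D := le_trans (by norm_num) hD
  have hℓ2 : 2 ≤ ell D := two_le_ell hD
  have hℓ1 : 1 ≤ ell D := by linarith
  have hℓ0 : ell D ≠ 0 := by linarith
  obtain ⟨hθlo, hθhi, hθd⟩ := theta2_bounds hℓ2
  set Λ : ℝ := ell D ^ 9 with hΛdef
  set θ₂ : ℝ := Real.log (Skeleton.P2 D) / Λ with hθ₂def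
  have hΛ : 0 < Λ := by rw [hΛdef]; positivity
  have hK0 : 0 ≤ K := by rw [hK]; positivity
  have hθ0 : 0 < θ₂ := by linarith
  have hlog : Real.log (bigP D) = Λ := by rw [bigP, Real.log_exp]
  have hP2 : Skeleton.P2 D = Ppow Λ θ₂ := P2_eq_Ppow hℓ0
  rw [hP2, hlog, display818_diag hΛ hθ0.ne'
    (F := frakfW c' D j 7) (G := frakgW c' D j 7) (f := fun z => frakfW c' D j 7 (rexp (Λ * z)))
    (g := fun z => frakgW c' D j 7 (rexp (Λ * z))) (fun _ => rfl) (fun _ => rfl)]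
  have hU : IntervalIntegrable (fun z => frakfW c' D j 7 (rexp (Λ * z)) * frakgW c' D j 7 (rexp (Λ * z)))
      volume 0 θ₂ :=
    ((continuous_frakfW_exp c' D j 7 Λ).mul (continuous_frakgW_exp c' D j 7 Λ)).intervalIntegrable _ _
  have hV : Continuous fun z => ffP j 7 z * ghP j 7 z :=
    (continuous_ffP_ghP j 7).1.mul (continuous_ffP_ghP j 7).2
  have hUV : ∀ z ∈ Icc (0:ℝ) θ₂,
      ‖frakfW c' D j 7 (rexp (Λ * z)) * frakgW c' D j 7 (rexp (Λ * z)) - ffP j 7 z * ghP j 7 z‖ ≤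
        (12 * K + K ^ 2) * (ell D ^ 8)⁻¹ := by
    intro z hz
    rw [hΛdef, ← bigP_rpow_eq_exp]
    exact product_close c' hD3 hj (Or.inr rfl) (Or.inr rfl) hz.1 (by linarith [hz.2]) hz.1
      (by linarith [hz.2])
  have hM : ∀ z ∈ Icc (0:ℝ) (max θ₂ 0.5), ‖ffP j 7 z * ghP j 7 z‖ ≤ 36 := by
    intro z hz
    have hz1 : z ≤ 1 := hz.2.trans (max_le (by linarith) (by norm_num))
    have hz' : |z| ≤ 1 := abs_le.mpr ⟨by linarith [hz.1], hz1⟩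
    rw [norm_mul]
    nlinarith [norm_ffP_le j 7 hz', norm_ghP_le j 7 hz', norm_nonneg (ffP j 7 z),
      norm_nonneg (ghP j 7 z)]
  have key := integral_perturbation (p := 1 / (θ₂ ^ 2 * Λ)) (p₀ := 1 / (0.5 ^ 2 * Λ))
    hθ0.le (by norm_num) hU hV hUV hM
  refine key.trans ?_
  obtain ⟨hp1, hp2⟩ := prefactor_diag hΛ hθlo hθhi
  have hαΛ : alpha D * Λ = π := by rw [hΛdef]; exact alpha_mul_ell_pow_nine hD3
  have hα0 : alpha D ≠ 0 := (alpha_pos' hD3).ne'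
  set t : ℝ := (ell D ^ 7)⁻¹ with htdef
  have ht0 : 0 ≤ t := by rw [htdef]; positivity
  have ht87 : (ell D ^ 8)⁻¹ ≤ t := by
    rw [htdef]; apply inv_anti₀ (by positivity)
    calc ell D ^ 7 = ell D ^ 7 * 1 := (mul_one _).symm
      _ ≤ ell D ^ 7 * ell D := by gcongr
      _ = ell D ^ 8 := by ring
  have hp2' : |1 / (θ₂ ^ 2 * Λ) - 1 / (0.5 ^ 2 * Λ)| ≤ 25 * (10 * t) / Λ :=
    hp2.trans (by gcongr)
  calc |1 / (θ₂ ^ 2 * Λ)| * (θ₂ * ((12 * K + K ^ 2) * (ell D ^ 8)⁻¹)) +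
        |1 / (θ₂ ^ 2 * Λ)| * (|θ₂ - 0.5| * 36) + |1 / (θ₂ ^ 2 * Λ) - 1 / (0.5 ^ 2 * Λ)| * (0.5 * 36)
      ≤ 7 / Λ * (0.5 * ((12 * K + K ^ 2) * t)) + 7 / Λ * (10 * t * 36) +
          25 * (10 * t) / Λ * (0.5 * 36) := by gcongr
    _ = (3.5 * (12 * K + K ^ 2) + 7020) / π * alpha D * t := by
        rw [← hαΛ]; field_simp; ring

/-- **`Z22:§8.u053`, quantitative** (p. 49, tex L2512): for `1 ≤ j ≤ 3`,
`‖(log P₁ log P₂)⁻¹ ∫₁^{P₂} 𝔣_{j7}(x)𝔤_{j6}(P^{0.004}T^{10}x) dx/x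
 − (0.5·0.504·log P)⁻¹ ∫₀^{0.5} 𝔣𝔣_{j7}(z)𝔤𝔥_{j6}(z + 0.004) dz‖ ≤ C·α·𝓛⁻⁷` for `D ≥ 8`
(`P^{0.004}T^{10} = P₁/P₂ = P^{0.504 − θ₂}`; Lipschitz of `𝔤𝔥_{j6}`). [cite: Zhang2022LandauSiegel, §8 p.49, tex L2512] -/
theorem step8u053q_holds : ∃ C : ℝ, ForAllLarge fun D _ _ => ∀ j ∈ ({1, 2, 3} : Finset ℕ),
    ‖1 / (Real.log (Skeleton.P1 D) * Real.log (Skeleton.P2 D) : ℂ) *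
          (∫ x in (1 : ℝ)..Skeleton.P2 D,
            frakfW c' D j 7 x * frakgW c' D j 6 (bigP D ^ (0.004 : ℝ) * bigT D ^ 10 * x) / x) -
        ((1 / (0.5 * 0.504 * Real.log (bigP D)) : ℝ) : ℂ) *
          ∫ z in (0 : ℝ)..0.5, ffP j 7 z * ghP j 6 (z + 0.004)‖ ≤ C * alpha D * (ell D ^ 7)⁻¹ := by
  set K : ℝ := 75 * |c'| * π ^ 2 + 40 * |c'| ^ 2 * π ^ 3 with hK
  refine ⟨(2.5 * (12 * K + K ^ 2 + 3000) + 3600) / π, 8, fun D _ χ hD _ _ j hj => ?_⟩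
  have hD3 : 3 ≤ D := le_trans (by norm_num) hD
  have hℓ2 : 2 ≤ ell D := two_le_ell hD
  have hℓ1 : 1 ≤ ell D := by linarith
  have hℓ0 : ell D ≠ 0 := by linarith
  obtain ⟨hθlo, hθhi, hθd⟩ := theta2_bounds hℓ2
  set Λ : ℝ := ell D ^ 9 with hΛdef
  set θ₂ : ℝ := Real.log (Skeleton.P2 D) / Λ with hθ₂def
  have hΛ : 0 < Λ := by rw [hΛdef]; positivity
  have hK0 : 0 ≤ K := by rw [hK]; positivity
  have hθ0 : 0 < θ₂ := by linarith
  have hlog : Real.log (bigP D) = Λ := by rw [bigP, Real.log_exp]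
  have hP2 : Skeleton.P2 D = Ppow Λ θ₂ := P2_eq_Ppow hℓ0
  rw [bigP_rpow_mul_bigT_pow, P1_eq_Ppow, hP2, hlog,
    display818_cross₁ hΛ (by norm_num : (0.504:ℝ) ≠ 0) hθ0.ne'
    (F7 := frakfW c' D j 7) (G6 := frakgW c' D j 6) (f7 := fun z => frakfW c' D j 7 (rexp (Λ * z)))
    (g6 := fun z => frakgW c' D j 6 (rexp (Λ * z))) (fun _ => rfl) (fun _ => rfl)]
  set s : ℝ := 0.504 - θ₂ with hsdef
  have hs0 : 0 ≤ s := by rw [hsdef]; linarith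
  have hs : |s - 0.004| ≤ 10 * (ell D ^ 7)⁻¹ := by
    rw [hsdef, show (0.504 : ℝ) - θ₂ - 0.004 = -(θ₂ - 0.5) by ring, abs_neg]; exact hθd
  have hU : IntervalIntegrable
      (fun z => frakfW c' D j 7 (rexp (Λ * z)) * frakgW c' D j 6 (rexp (Λ * (z + s)))) volume 0 θ₂ :=
    ((continuous_frakfW_exp c' D j 7 Λ).mul
      ((continuous_frakgW_exp c' D j 6 Λ).comp (continuous_id.add continuous_const))).intervalIntegrable
      _ _
  have hV : Continuous fun z => ffP j 7 z * ghP j 6 (z + 0.004) :=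
    (continuous_ffP_ghP j 7).1.mul ((continuous_ffP_ghP j 6).2.comp (continuous_id.add continuous_const))
  have hUV : ∀ z ∈ Icc (0:ℝ) θ₂,
      ‖frakfW c' D j 7 (rexp (Λ * z)) * frakgW c' D j 6 (rexp (Λ * (z + s))) -
          ffP j 7 z * ghP j 6 (z + 0.004)‖ ≤ (12 * K + K ^ 2 + 3000) * (ell D ^ 7)⁻¹ := by
    intro z hz
    have hz1 : z ≤ 0.5 := hz.2.trans hθhi
    have hzs0 : 0 ≤ z + s := by linarith [hz.1]
    have hzs1 : z + s ≤ 1 := by rw [hsdef]; linarith [hz.2]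
    have hw : |z + 0.004| ≤ 1 := abs_le.mpr ⟨by linarith [hz.1], by linarith⟩
    have hz' : |z| ≤ 1 := abs_le.mpr ⟨by linarith [hz.1], by linarith⟩
    have h1 := product_close c' hD3 hj (Or.inr rfl) (Or.inl rfl) hz.1 (by linarith) hzs0 hzs1
    rw [bigP_rpow_eq_exp, bigP_rpow_eq_exp, ← hΛdef] at h1
    have h2 : ‖ffP j 7 z * ghP j 6 (z + s) - ffP j 7 z * ghP j 6 (z + 0.004)‖ ≤ 6 * (50 * |s - 0.004|) := by
      rw [← mul_sub, norm_mul]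
      refine mul_le_mul (norm_ffP_le j 7 hz') ?_ (norm_nonneg _) (by norm_num)
      have := ghP_six_sub_le j (z := z + s) hw
      rwa [show z + s - (z + 0.004) = s - 0.004 by ring] at this
    have ht87 : (ell D ^ 8)⁻¹ ≤ (ell D ^ 7)⁻¹ := by
      apply inv_anti₀ (by positivity)
      calc ell D ^ 7 = ell D ^ 7 * 1 := (mul_one _).symm
        _ ≤ ell D ^ 7 * ell D := by gcongr
        _ = ell D ^ 8 := by ring
    have h12 : 0 ≤ 12 * K + K ^ 2 := by positivity
    calc ‖frakfW c' D j 7 (rexp (Λ * z)) * frakgW c' D j 6 (rexp (Λ * (z + s))) -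
            ffP j 7 z * ghP j 6 (z + 0.004)‖
        ≤ ‖frakfW c' D j 7 (rexp (Λ * z)) * frakgW c' D j 6 (rexp (Λ * (z + s))) -
              ffP j 7 z * ghP j 6 (z + s)‖ +
            ‖ffP j 7 z * ghP j 6 (z + s) - ffP j 7 z * ghP j 6 (z + 0.004)‖ := norm_sub_le_norm_sub_add_norm_sub _ _ _
      _ ≤ (12 * K + K ^ 2) * (ell D ^ 8)⁻¹ + 6 * (50 * |s - 0.004|) := add_le_add h1 h2
      _ ≤ (12 * K + K ^ 2) * (ell D ^ 7)⁻¹ + 6 * (50 * (10 * (ell D ^ 7)⁻¹)) := by gcongr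
      _ = (12 * K + K ^ 2 + 3000) * (ell D ^ 7)⁻¹ := by ring
  have hM : ∀ z ∈ Icc (0:ℝ) (max θ₂ 0.5), ‖ffP j 7 z * ghP j 6 (z + 0.004)‖ ≤ 36 := by
    intro z hz
    have hz1 : z ≤ 0.5 := hz.2.trans (max_le hθhi le_rfl)
    have hz' : |z| ≤ 1 := abs_le.mpr ⟨by linarith [hz.1], by linarith⟩
    have hw : |z + 0.004| ≤ 1 := abs_le.mpr ⟨by linarith [hz.1], by linarith⟩
    rw [norm_mul]
    nlinarith [norm_ffP_le j 7 hz', norm_ghP_le j 6 hw, norm_nonneg (ffP j 7 z),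
      norm_nonneg (ghP j 6 (z + 0.004))]
  have key := integral_perturbation (p := 1 / (0.504 * θ₂ * Λ)) (p₀ := 1 / (0.5 * 0.504 * Λ))
    hθ0.le (by norm_num) hU hV hUV hM
  refine key.trans ?_
  obtain ⟨hp1, hp2⟩ := prefactor_cross hΛ hθlo
  have hαΛ : alpha D * Λ = π := by rw [hΛdef]; exact alpha_mul_ell_pow_nine hD3
  have hα0 : alpha D ≠ 0 := (alpha_pos' hD3).ne'
  set t : ℝ := (ell D ^ 7)⁻¹ with htdef
  have ht0 : 0 ≤ t := by rw [htdef]; positivity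
  have hp2' : |1 / (0.504 * θ₂ * Λ) - 1 / (0.5 * 0.504 * Λ)| ≤ 10 * (10 * t) / Λ :=
    hp2.trans (by gcongr)
  have h12 : 0 ≤ 12 * K + K ^ 2 + 3000 := by positivity
  calc |1 / (0.504 * θ₂ * Λ)| * (θ₂ * ((12 * K + K ^ 2 + 3000) * t)) +
        |1 / (0.504 * θ₂ * Λ)| * (|θ₂ - 0.5| * 36) +
        |1 / (0.504 * θ₂ * Λ) - 1 / (0.5 * 0.504 * Λ)| * (0.5 * 36)
      ≤ 5 / Λ * (0.5 * ((12 * K + K ^ 2 + 3000) * t)) + 5 / Λ * (10 * t * 36) +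
          10 * (10 * t) / Λ * (0.5 * 36) := by gcongr
    _ = (2.5 * (12 * K + K ^ 2 + 3000) + 3600) / π * alpha D * t := by
        rw [← hαΛ]; field_simp; ring

/-- **`Z22:§8.u054`, quantitative** (p. 49, tex L2517): for `1 ≤ j ≤ 3`,
`‖(log P₁ log P₂)⁻¹ ∫₁^{P₂} 𝔣_{j6}(P^{0.004}T^{10}x)𝔤_{j7}(x) dx/x
 − (0.5·0.504·log P)⁻¹ ∫₀^{0.5} 𝔣𝔣_{j6}(z + 0.004)𝔤𝔥_{j7}(z) dz‖ ≤ C·α·𝓛⁻⁷` for `D ≥ 8`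
(Lipschitz of `𝔣𝔣_{j6}`). [cite: Zhang2022LandauSiegel, §8 p.49, tex L2517] -/
theorem step8u054q_holds : ∃ C : ℝ, ForAllLarge fun D _ _ => ∀ j ∈ ({1, 2, 3} : Finset ℕ),
    ‖1 / (Real.log (Skeleton.P1 D) * Real.log (Skeleton.P2 D) : ℂ) *
          (∫ x in (1 : ℝ)..Skeleton.P2 D,
            frakfW c' D j 6 (bigP D ^ (0.004 : ℝ) * bigT D ^ 10 * x) * frakgW c' D j 7 x / x) -
        ((1 / (0.5 * 0.504 * Real.log (bigP D)) : ℝ) : ℂ) *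
          ∫ z in (0 : ℝ)..0.5, ffP j 6 (z + 0.004) * ghP j 7 z‖ ≤ C * alpha D * (ell D ^ 7)⁻¹ := by
  set K : ℝ := 75 * |c'| * π ^ 2 + 40 * |c'| ^ 2 * π ^ 3 with hK
  refine ⟨(2.5 * (12 * K + K ^ 2 + 3000) + 3600) / π, 8, fun D _ χ hD _ _ j hj => ?_⟩
  have hD3 : 3 ≤ D := le_trans (by norm_num) hD
  have hℓ2 : 2 ≤ ell D := two_le_ell hD
  have hℓ1 : 1 ≤ ell D := by linarith
  have hℓ0 : ell D ≠ 0 := by linarith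
  obtain ⟨hθlo, hθhi, hθd⟩ := theta2_bounds hℓ2
  set Λ : ℝ := ell D ^ 9 with hΛdef
  set θ₂ : ℝ := Real.log (Skeleton.P2 D) / Λ with hθ₂def
  have hΛ : 0 < Λ := by rw [hΛdef]; positivity
  have hK0 : 0 ≤ K := by rw [hK]; positivity
  have hθ0 : 0 < θ₂ := by linarith
  have hlog : Real.log (bigP D) = Λ := by rw [bigP, Real.log_exp]
  have hP2 : Skeleton.P2 D = Ppow Λ θ₂ := P2_eq_Ppow hℓ0
  rw [bigP_rpow_mul_bigT_pow, P1_eq_Ppow, hP2, hlog,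
    display818_cross₂ hΛ (by norm_num : (0.504:ℝ) ≠ 0) hθ0.ne'
    (F6 := frakfW c' D j 6) (G7 := frakgW c' D j 7) (f6 := fun z => frakfW c' D j 6 (rexp (Λ * z)))
    (g7 := fun z => frakgW c' D j 7 (rexp (Λ * z))) (fun _ => rfl) (fun _ => rfl)]
  set s : ℝ := 0.504 - θ₂ with hsdef
  have hs0 : 0 ≤ s := by rw [hsdef]; linarith
  have hs : |s - 0.004| ≤ 10 * (ell D ^ 7)⁻¹ := by
    rw [hsdef, show (0.504 : ℝ) - θ₂ - 0.004 = -(θ₂ - 0.5) by ring, abs_neg]; exact hθd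
  have hU : IntervalIntegrable
      (fun z => frakfW c' D j 6 (rexp (Λ * (z + s))) * frakgW c' D j 7 (rexp (Λ * z))) volume 0 θ₂ :=
    (((continuous_frakfW_exp c' D j 6 Λ).comp (continuous_id.add continuous_const)).mul
      (continuous_frakgW_exp c' D j 7 Λ)).intervalIntegrable _ _
  have hV : Continuous fun z => ffP j 6 (z + 0.004) * ghP j 7 z :=
    ((continuous_ffP_ghP j 6).1.comp (continuous_id.add continuous_const)).mul (continuous_ffP_ghP j 7).2
  have hUV : ∀ z ∈ Icc (0:ℝ) θ₂,
      ‖frakfW c' D j 6 (rexp (Λ * (z + s))) * frakgW c' D j 7 (rexp (Λ * z)) -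
          ffP j 6 (z + 0.004) * ghP j 7 z‖ ≤ (12 * K + K ^ 2 + 3000) * (ell D ^ 7)⁻¹ := by
    intro z hz
    have hz1 : z ≤ 0.5 := hz.2.trans hθhi
    have hzs0 : 0 ≤ z + s := by linarith [hz.1]
    have hzs1 : z + s ≤ 1 := by rw [hsdef]; linarith [hz.2]
    have hw : |z + 0.004| ≤ 1 := abs_le.mpr ⟨by linarith [hz.1], by linarith⟩
    have hz' : |z| ≤ 1 := abs_le.mpr ⟨by linarith [hz.1], by linarith⟩
    have h1 := product_close c' hD3 hj (Or.inl rfl) (Or.inr rfl) hzs0 hzs1 hz.1 (by linarith)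
    rw [bigP_rpow_eq_exp, bigP_rpow_eq_exp, ← hΛdef] at h1
    have h2 : ‖ffP j 6 (z + s) * ghP j 7 z - ffP j 6 (z + 0.004) * ghP j 7 z‖ ≤ 50 * |s - 0.004| * 6 := by
      rw [← sub_mul, norm_mul]
      refine mul_le_mul ?_ (norm_ghP_le j 7 hz') (norm_nonneg _) (by positivity)
      have := ffP_six_sub_le j (z := z + s) hw
      rwa [show z + s - (z + 0.004) = s - 0.004 by ring] at this
    have ht87 : (ell D ^ 8)⁻¹ ≤ (ell D ^ 7)⁻¹ := by
      apply inv_anti₀ (by positivity)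
      calc ell D ^ 7 = ell D ^ 7 * 1 := (mul_one _).symm
        _ ≤ ell D ^ 7 * ell D := by gcongr
        _ = ell D ^ 8 := by ring
    have h12 : 0 ≤ 12 * K + K ^ 2 := by positivity
    calc ‖frakfW c' D j 6 (rexp (Λ * (z + s))) * frakgW c' D j 7 (rexp (Λ * z)) -
            ffP j 6 (z + 0.004) * ghP j 7 z‖
        ≤ ‖frakfW c' D j 6 (rexp (Λ * (z + s))) * frakgW c' D j 7 (rexp (Λ * z)) -
              ffP j 6 (z + s) * ghP j 7 z‖ +
            ‖ffP j 6 (z + s) * ghP j 7 z - ffP j 6 (z + 0.004) * ghP j 7 z‖ :=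
          norm_sub_le_norm_sub_add_norm_sub _ _ _
      _ ≤ (12 * K + K ^ 2) * (ell D ^ 8)⁻¹ + 50 * |s - 0.004| * 6 := add_le_add h1 h2
      _ ≤ (12 * K + K ^ 2) * (ell D ^ 7)⁻¹ + 50 * (10 * (ell D ^ 7)⁻¹) * 6 := by gcongr
      _ = (12 * K + K ^ 2 + 3000) * (ell D ^ 7)⁻¹ := by ring
  have hM : ∀ z ∈ Icc (0:ℝ) (max θ₂ 0.5), ‖ffP j 6 (z + 0.004) * ghP j 7 z‖ ≤ 36 := by
    intro z hz
    have hz1 : z ≤ 0.5 := hz.2.trans (max_le hθhi le_rfl)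
    have hz' : |z| ≤ 1 := abs_le.mpr ⟨by linarith [hz.1], by linarith⟩
    have hw : |z + 0.004| ≤ 1 := abs_le.mpr ⟨by linarith [hz.1], by linarith⟩
    rw [norm_mul]
    nlinarith [norm_ffP_le j 6 hw, norm_ghP_le j 7 hz', norm_nonneg (ffP j 6 (z + 0.004)),
      norm_nonneg (ghP j 7 z)]
  have key := integral_perturbation (p := 1 / (0.504 * θ₂ * Λ)) (p₀ := 1 / (0.5 * 0.504 * Λ))
    hθ0.le (by norm_num) hU hV hUV hM
  refine key.trans ?_
  obtain ⟨hp1, hp2⟩ := prefactor_cross hΛ hθlo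
  have hαΛ : alpha D * Λ = π := by rw [hΛdef]; exact alpha_mul_ell_pow_nine hD3
  have hα0 : alpha D ≠ 0 := (alpha_pos' hD3).ne'
  set t : ℝ := (ell D ^ 7)⁻¹ with htdef
  have ht0 : 0 ≤ t := by rw [htdef]; positivity
  have hp2' : |1 / (0.504 * θ₂ * Λ) - 1 / (0.5 * 0.504 * Λ)| ≤ 10 * (10 * t) / Λ :=
    hp2.trans (by gcongr)
  have h12 : 0 ≤ 12 * K + K ^ 2 + 3000 := by positivity
  calc |1 / (0.504 * θ₂ * Λ)| * (θ₂ * ((12 * K + K ^ 2 + 3000) * t)) +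
        |1 / (0.504 * θ₂ * Λ)| * (|θ₂ - 0.5| * 36) +
        |1 / (0.504 * θ₂ * Λ) - 1 / (0.5 * 0.504 * Λ)| * (0.5 * 36)
      ≤ 5 / Λ * (0.5 * ((12 * K + K ^ 2 + 3000) * t)) + 5 / Λ * (10 * t * 36) +
          10 * (10 * t) / Λ * (0.5 * 36) := by gcongr
    _ = (2.5 * (12 * K + K ^ 2 + 3000) + 3600) / π * alpha D * t := by
        rw [← hαΛ]; field_simp; ring

end Quantitative

/-! ## The typed `o(α)` forms `Section8dStatements.Step8u051 c′` – `Step8u054 c′`, PROVED -/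

section Typed

variable (c' : ℝ)

/-- `C·𝓛⁻⁷ ≤ ε` for `D ≥ ⌈e^{|C|/ε + 1}⌉`. [cite: Zhang2022LandauSiegel, §2 (2.1)] -/
theorem const_mul_inv_ell_seven_le (C : ℝ) {ε : ℝ} (hε : 0 < ε) :
    ∃ D₁ : ℕ, ∀ D : ℕ, D₁ ≤ D → C * (ell D ^ 7)⁻¹ ≤ ε := by
  refine ⟨⌈Real.exp (|C| / ε + 1)⌉₊, fun D hD => ?_⟩
  have hexp : Real.exp (|C| / ε + 1) ≤ D := (Nat.le_ceil _).trans (by exact_mod_cast hD)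
  have hDpos : (0 : ℝ) < D := lt_of_lt_of_le (Real.exp_pos _) hexp
  have hℓ : |C| / ε + 1 ≤ ell D := by rw [ell]; exact (Real.le_log_iff_exp_le hDpos).mpr hexp
  have hC : 0 ≤ |C| / ε := by positivity
  have hℓ1 : 1 ≤ ell D := by linarith
  have h7 : |C| / ε + 1 ≤ ell D ^ 7 := hℓ.trans (le_self_pow₀ hℓ1 (by norm_num))
  have hpos : 0 < |C| / ε + 1 := by linarith
  have h7inv : 0 ≤ (ell D ^ 7)⁻¹ := inv_nonneg.mpr (pow_nonneg (by linarith) 7)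
  calc C * (ell D ^ 7)⁻¹ ≤ |C| * (ell D ^ 7)⁻¹ := mul_le_mul_of_nonneg_right (le_abs_self C) h7inv
    _ ≤ |C| * (|C| / ε + 1)⁻¹ := by gcongr
    _ ≤ ε := by
        rw [← div_eq_mul_inv, div_le_iff₀ hpos]
        nlinarith [abs_nonneg C, mul_pos hε hε, div_mul_cancel₀ |C| hε.ne']

/-- From the quantitative form `≤ C·α·𝓛⁻⁷` to the typed `o(α)` form. [cite: Zhang2022LandauSiegel, §8 p.49] -/
theorem oalpha_of_quantitative {S : (D : ℕ) → ℕ → ℝ} {C : ℝ}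
    (h : ForAllLarge fun D _ _ => ∀ j ∈ ({1, 2, 3} : Finset ℕ), S D j ≤ C * alpha D * (ell D ^ 7)⁻¹) :
    ∀ ε : ℝ, 0 < ε → ForAllLarge fun D _ _ => ∀ j ∈ ({1, 2, 3} : Finset ℕ), S D j ≤ ε * alpha D := by
  intro ε hε
  obtain ⟨D₀, h0⟩ := h
  obtain ⟨D₁, h1⟩ := const_mul_inv_ell_seven_le C hε
  refine ⟨max (max D₀ D₁) 3, fun D _ χ hD hq hp j hj => ?_⟩
  have hD01 : max D₀ D₁ ≤ D := le_of_max_le_left hD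
  have hD3 : 3 ≤ D := le_of_max_le_right hD
  have hS := h0 D χ (le_of_max_le_left hD01) hq hp j hj
  have hC := h1 D (le_of_max_le_right hD01)
  calc S D j ≤ C * alpha D * (ell D ^ 7)⁻¹ := hS
    _ = C * (ell D ^ 7)⁻¹ * alpha D := by ring
    _ ≤ ε * alpha D := mul_le_mul_of_nonneg_right hC (alpha_pos' hD3).le

/-- **`Z22:§8.u051` DISCHARGED**: `Section8dStatements.Step8u051 c′` holds.
[cite: Zhang2022LandauSiegel, §8 p.49, tex L2506] -/
theorem step8u051_holds : Step8u051 c' := by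
  obtain ⟨C, h⟩ := step8u051q_holds c'
  exact oalpha_of_quantitative (S := fun D j => ‖1 / (Real.log (Skeleton.P1 D) : ℂ) ^ 2 *
          (∫ x in (1 : ℝ)..Skeleton.P1 D, frakfW c' D j 6 x * frakgW c' D j 6 x / x) -
        ((1 / (0.504 ^ 2 * Real.log (bigP D)) : ℝ) : ℂ) *
          ∫ z in (0 : ℝ)..0.504, ffP j 6 z * ghP j 6 z‖) h

/-- `Step8u051` — `_holds` alias of `step8u051_holds` above under the fact's exact name (appended
2026-08-28, D-0026 bookkeeping: the proof term is the existing theorem of this file; no statement,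
definition or attribute is edited; no new named fact; the ledger's debt table listed the fact
unproved). [cite: Zhang2022LandauSiegel, §8 p.49, tex L2506] -/
theorem _root_.Literature.NumberTheory.LFunctions.Zhang2022.Section8dStatements.Step8u051_holds :
    Step8u051 c' :=
  _root_.Literature.NumberTheory.LFunctions.Zhang2022.Section8SubstitutionDisplays.step8u051_holds (c' := c')

/-- **`Z22:§8.u052` DISCHARGED**: `Section8dStatements.Step8u052 c′` holds.
[cite: Zhang2022LandauSiegel, §8 p.49, tex L2509] -/
theorem step8u052_holds : Step8u052 c' := by
  obtain ⟨C, h⟩ := step8u052q_holds c'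
  exact oalpha_of_quantitative (S := fun D j => ‖1 / (Real.log (Skeleton.P2 D) : ℂ) ^ 2 *
          (∫ x in (1 : ℝ)..Skeleton.P2 D, frakfW c' D j 7 x * frakgW c' D j 7 x / x) -
        ((1 / (0.5 ^ 2 * Real.log (bigP D)) : ℝ) : ℂ) *
          ∫ z in (0 : ℝ)..0.5, ffP j 7 z * ghP j 7 z‖) h

/-- `Step8u052` — `_holds` alias of `step8u052_holds` above under the fact's exact name (appended
2026-08-28, D-0026 bookkeeping: the proof term is the existing theorem of this file; no statement,
definition or attribute is edited; no new named fact; the ledger's debt table listed the fact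
unproved). [cite: Zhang2022LandauSiegel, §8 p.49, tex L2509] -/
theorem _root_.Literature.NumberTheory.LFunctions.Zhang2022.Section8dStatements.Step8u052_holds :
    Step8u052 c' :=
  _root_.Literature.NumberTheory.LFunctions.Zhang2022.Section8SubstitutionDisplays.step8u052_holds (c' := c')

/-- **`Z22:§8.u053` DISCHARGED**: `Section8dStatements.Step8u053 c′` holds.
[cite: Zhang2022LandauSiegel, §8 p.49, tex L2512] -/
theorem step8u053_holds : Step8u053 c' := by
  obtain ⟨C, h⟩ := step8u053q_holds c'
  exact oalpha_of_quantitative (S := fun D j =>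
    ‖1 / (Real.log (Skeleton.P1 D) * Real.log (Skeleton.P2 D) : ℂ) *
          (∫ x in (1 : ℝ)..Skeleton.P2 D,
            frakfW c' D j 7 x * frakgW c' D j 6 (bigP D ^ (0.004 : ℝ) * bigT D ^ 10 * x) / x) -
        ((1 / (0.5 * 0.504 * Real.log (bigP D)) : ℝ) : ℂ) *
          ∫ z in (0 : ℝ)..0.5, ffP j 7 z * ghP j 6 (z + 0.004)‖) h

/-- `Step8u053` — `_holds` alias of `step8u053_holds` above under the fact's exact name (appended
2026-08-28, D-0026 bookkeeping: the proof term is the existing theorem of this file; no statement,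
definition or attribute is edited; no new named fact; the ledger's debt table listed the fact
unproved). [cite: Zhang2022LandauSiegel, §8 p.49, tex L2512] -/
theorem _root_.Literature.NumberTheory.LFunctions.Zhang2022.Section8dStatements.Step8u053_holds :
    Step8u053 c' :=
  _root_.Literature.NumberTheory.LFunctions.Zhang2022.Section8SubstitutionDisplays.step8u053_holds (c' := c')

/-- **`Z22:§8.u054` DISCHARGED**: `Section8dStatements.Step8u054 c′` holds.
[cite: Zhang2022LandauSiegel, §8 p.49, tex L2517] -/
theorem step8u054_holds : Step8u054 c' := by
  obtain ⟨C, h⟩ := step8u054q_holds c'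
  exact oalpha_of_quantitative (S := fun D j =>
    ‖1 / (Real.log (Skeleton.P1 D) * Real.log (Skeleton.P2 D) : ℂ) *
          (∫ x in (1 : ℝ)..Skeleton.P2 D,
            frakfW c' D j 6 (bigP D ^ (0.004 : ℝ) * bigT D ^ 10 * x) * frakgW c' D j 7 x / x) -
        ((1 / (0.5 * 0.504 * Real.log (bigP D)) : ℝ) : ℂ) *
          ∫ z in (0 : ℝ)..0.5, ffP j 6 (z + 0.004) * ghP j 7 z‖) h

/-- `Step8u054` — `_holds` alias of `step8u054_holds` above under the fact's exact name (appended
2026-08-28, D-0026 bookkeeping: the proof term is the existing theorem of this file; no statement,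
definition or attribute is edited; no new named fact; the ledger's debt table listed the fact
unproved). [cite: Zhang2022LandauSiegel, §8 p.49, tex L2517] -/
theorem _root_.Literature.NumberTheory.LFunctions.Zhang2022.Section8dStatements.Step8u054_holds :
    Step8u054 c' :=
  _root_.Literature.NumberTheory.LFunctions.Zhang2022.Section8SubstitutionDisplays.step8u054_holds (c' := c')

end Typed

end Literature.NumberTheory.LFunctions.Zhang2022.Section8SubstitutionDisplays
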